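import Literature.NumberTheory.LFunctions.WeilTwoPrimeCertificateDeflated
import HarnessLib

/-!
# Penalty polynomials of the deflated two-prime certificate

Topic `Literature/NumberTheory/LFunctions`; companion of `WeilTwoPrimeCertificateDeflated.lean`.  The rank-one terms of a deflated
certificate are `μ_r |Σ_{k<n} ĉ_{rk} M_k(g)|²` with the scaled moments `M_k(g) = ∫ g(x)(x/a₀)^k dx` and the parity-masked
coefficients `ĉ = maskV r`.  This file names the PENALTY POLYNOMIAL `p_r(x) = Σ_{k<n} ĉ_{rk}(x/a₀)^k` (`maskPoly`) and proves
`Σ_k ĉ_{rk} M_k(g) = ∫ g · p_r` (`sum_maskV_mul_weilMoment`, `rankOne_sum_eq_integral`), together with the smoothness and the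
parity of `p_r` (`contDiff_maskPoly`, `maskPoly_neg_of_odd`, `maskPoly_neg_of_even`) — the form in which the deflated Temple /
Lehmann–Maehly L-side (`GroundBartaEvenWinsBeyondArchDeflationRitz.lean`, trial vectors `v_i = 𝟙_{[-c,c]} · p_i`) consumes the
certificate.  All proved; no named facts.

## References
* H. Yoshida, *On Hermitian forms attached to zeta functions*, Adv. Stud. Pure Math. 21 (1992), §6. [Yoshida1992]
-/

noncomputable section

open Complex Finset MeasureTheory Set Filter
open scoped Real Topology ComplexConjugate BigOperators

namespace Literature.NumberTheory.LFunctions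


/-- The masked penalty polynomial `p_r(x) = Σ_{k < n} ĉ_k (x/a)^k` of a rank-one term `r = (μ, q, c)`. [folklore] -/
def maskPoly (r : ℚ × ℕ × List ℚ) (n : ℕ) (a x : ℝ) : ℝ :=
  ∑ k ∈ range n, ((maskV r k : ℚ) : ℝ) * (x / a) ^ k

/-- **The rank-one form is the square modulus of an integral against a polynomial**: for a test function `g`,
`Σ_{k < n} ĉ_k M_k(g) = ∫ g(x) p_r(x) dx` with `p_r(x) = Σ_{k<n} ĉ_k (x/a)^k` (`M_k(g) = ∫ g(x)(x/a)^k dx`). [folklore] -/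
theorem sum_maskV_mul_weilMoment (r : ℚ × ℕ × List ℚ) (n : ℕ) (a : ℝ) {g : ℝ → ℂ} (hg : IsWeilTest g) :
    ∑ k ∈ range n, ((maskV r k : ℚ) : ℂ) * weilMoment a g k = ∫ x, g x * (maskPoly r n a x : ℂ) := by
  have hgc : Continuous g := hg.1.continuous
  have hint : ∀ k : ℕ, Integrable fun x : ℝ ↦ ((maskV r k : ℚ) : ℂ) * (g x * (((x / a) ^ k : ℝ) : ℂ)) := by
    intro k
    refine Integrable.const_mul ?_ _
    exact (hgc.mul (Complex.continuous_ofReal.comp ((continuous_id.div_const a).pow k))).integrable_of_hasCompactSupport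
      hg.2.mul_right
  unfold weilMoment
  simp_rw [← integral_const_mul]
  rw [← integral_finsetSum _ fun k _ ↦ hint k]
  refine integral_congr_ae (Eventually.of_forall fun x ↦ ?_)
  simp only [maskPoly]
  push_cast
  rw [Finset.mul_sum]
  refine Finset.sum_congr rfl fun k _ ↦ ?_
  ring

/-- The rank-one sum of a certificate, rewritten with polynomial integrals:
`Σ_{r ∈ R} μ_r |Σ_k ĉ_{rk} M_k(g)|² = Σ_{r ∈ R} μ_r |∫ g p_r|²`. [folklore] -/
theorem rankOne_sum_eq_integral (R : List (ℚ × ℕ × List ℚ)) (n : ℕ) (a : ℝ) {g : ℝ → ℂ} (hg : IsWeilTest g) :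
    (R.map fun r ↦ (r.1 : ℝ) * ‖∑ k ∈ range n, ((maskV r k : ℚ) : ℂ) * weilMoment a g k‖ ^ 2).sum =
      (R.map fun r ↦ (r.1 : ℝ) * ‖∫ x, g x * (maskPoly r n a x : ℂ)‖ ^ 2).sum := by
  congr 1
  refine List.map_congr_left fun r _ ↦ ?_
  rw [sum_maskV_mul_weilMoment r n a hg]

/-- The penalty polynomial is smooth. [folklore] -/
theorem contDiff_maskPoly (r : ℚ × ℕ × List ℚ) (n : ℕ) (a : ℝ) {m : WithTop ℕ∞} :
    ContDiff ℝ m (fun x : ℝ ↦ maskPoly r n a x) := by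
  unfold maskPoly
  refine ContDiff.sum fun k _ ↦ ?_
  exact contDiff_const.mul ((contDiff_id.div_const a).pow k)

/-- Masked coefficients vanish off the parity class of `q`. [folklore] -/
theorem maskV_eq_zero_of_mod_ne (r : ℚ × ℕ × List ℚ) {k : ℕ} (hk : k % 2 ≠ r.2.1 % 2) : maskV r k = 0 := by
  unfold maskV; rw [if_neg hk]

/-- For odd parity data (`q` odd) the penalty polynomial is odd. [folklore] -/
theorem maskPoly_neg_of_odd (r : ℚ × ℕ × List ℚ) (hq : r.2.1 % 2 = 1) (n : ℕ) (a x : ℝ) :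
    maskPoly r n a (-x) = -maskPoly r n a x := by
  unfold maskPoly
  rw [← Finset.sum_neg_distrib]
  refine Finset.sum_congr rfl fun k _ ↦ ?_
  by_cases hk : k % 2 = r.2.1 % 2
  · have hodd : Odd k := Nat.odd_iff.2 (hk.trans hq)
    rw [neg_div, hodd.neg_pow]; ring
  · rw [maskV_eq_zero_of_mod_ne r hk]; push_cast; ring

/-- For even parity data (`q` even) the penalty polynomial is even. [folklore] -/
theorem maskPoly_neg_of_even (r : ℚ × ℕ × List ℚ) (hq : r.2.1 % 2 = 0) (n : ℕ) (a x : ℝ) :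
    maskPoly r n a (-x) = maskPoly r n a x := by
  unfold maskPoly
  refine Finset.sum_congr rfl fun k _ ↦ ?_
  by_cases hk : k % 2 = r.2.1 % 2
  · have hev : Even k := Nat.even_iff.2 (hk.trans hq)
    rw [neg_div, hev.neg_pow]
  · rw [maskV_eq_zero_of_mod_ne r hk]; push_cast; ring

end Literature.NumberTheory.LFunctions

end
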